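import Literature.Analysis.FluidPDE.BilliardTensorMeasureBoundary
import Literature.Analysis.FluidPDE.BilliardTensorMeasureTrace
import HarnessLib

/-!
# Divergence-controlled matrix measures on `ℝ × T^d`: the vocabulary of Compensated Integrability

The objects of D. Serre's Compensated Integrability on `ℝ^k × T^m` (Serre 2024 §1.1–1.2, here
`k = 1`, `m = d`) are symmetric positive semidefinite tensors `A = (a_{αβ})` whose entries are
finite Radon measures and whose row-wise divergence `Div A` is a finite (vector) measure
("Div-BV"); the functional inequality (FIper), Thm. 3, controls `∫ (det A)^{1/(n-1)}` by
`‖Div A‖_M + ‖Tr_m A‖_M`, and Thm. 11 adds the determinantal masses. This file fixes the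
minimal vocabulary in which these statements can be written against the objects of this library
(`MatrixMeasure (Option d) (ℝ × UnitAddTorus d)`, index `none` = time), and records that the
billiard tensor of `BilliardTensorMeasure` is such an object:

* `MatrixMeasure.HasSpaceTimeDiv A ν` — `A` has the row-wise divergence measure
  `ν = (ν_α)_α` in the tested sense: for all `C¹` bounded test fields `Ψ = (ψ₀, ψ)` with bounded
  space–time derivatives, `⟨A, ∇_{t,y}Ψ⟩ = -Σ_α ∫ Ψ_α dν_α` (pairing of
  `ReynoldsDefectMeasure`, Jacobian matrix `stGradMatrix` of `BilliardTensorMeasureDivFree`);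
* `MatrixMeasure.spatialTraceMass A = Σ_{i ∈ d} A_{ii}(univ)` — the mass of `Tr_m A` for
  `A ⪰ 0` (Serre's `‖Tr_m A‖_M`);
* `integrable_sliceEntry` — bounded measurable functions are integrable against slice measures;
* **`IsHardSphereTrajectory.billiardTensor_hasSpaceTimeDiv`** — `M = billiardTensor ε γ a b`
  has divergence measure `ν_α = σ^a_α - σ^b_α` (the slice measures of
  `BilliardTensorMeasureBoundary`): Serre 2024 §5 (16);
  `IsHardSphereTrajectory.spatialTraceMass_billiardTensor'` — (17) in this vocabulary.

Not here (the theorems of the theory, all XL): (FIper) Thm. 3, determinantal masses and Thm. 11,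
the measure `(det A)^{1/n}`.

## References

* D. Serre, *Compensated integrability on tori; a priori estimate for space-periodic gas flows*,
  C. R. Math. Acad. Sci. Paris 362 (2024) 1425–1444, §1.1–1.2 (Div-BV tensors, Thm. 3), §5
  (16)–(17). [Serre2024]
-/

open Set Filter Function MeasureTheory
open scoped InnerProductSpace Topology

namespace Literature.Analysis.FluidPDE

noncomputable section

open Literature.Analysis.FunctionSpaces

variable {d : Type*} [Fintype d] [DecidableEq d] {N : ℕ}

namespace MatrixMeasure

/-- **Row-wise divergence measure (tested).** The matrix measure `A` on `ℝ × T^d` has the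
divergence measure `ν = (ν_α)` if for every `C¹` test field `Ψ = (ψ₀, ψ)`, bounded with bounded
space–time derivatives, `⟨A, ∇_{t,y}Ψ⟩ = -Σ_α ∫ Ψ_α dν_α` — Serre's "Div-BV" tensors are those
admitting such a finite `ν` (Serre 2024 §1.1, "Divergence control").
[cite: Serre2024, §1.1] -/
def HasSpaceTimeDiv (A : MatrixMeasure (Option d) (ℝ × UnitAddTorus d))
    (ν : Option d → SignedMeasure (ℝ × UnitAddTorus d)) : Prop :=
  ∀ (ψ₀ : ℝ → UnitAddTorus d → ℝ) (ψ : ℝ → UnitAddTorus d → EuclideanSpace ℝ d),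
    ContDiff ℝ 1 (Torus.stLift ψ₀) → ContDiff ℝ 1 (Torus.stLift ψ) →
    (∃ C : ℝ, (∀ p, ‖fderiv ℝ (Torus.stLift ψ₀) p‖ ≤ C) ∧ ∀ p, ‖fderiv ℝ (Torus.stLift ψ) p‖ ≤ C) →
    (∃ C : ℝ, (∀ t x, |ψ₀ t x| ≤ C) ∧ ∀ t x, ‖ψ t x‖ ≤ C) →
      A.pairing (stGradMatrix ψ₀ ψ) =
        -∑ α : Option d, ∫ᵛ q, (α.elim (ψ₀ q.1 q.2) fun k => ψ q.1 q.2 k) ∂<•(ν α)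

omit [DecidableEq d] in
/-- **The mass of the spatial trace** `Tr_m A = Σ_{i ∈ d} A_{ii}` of a matrix measure on
`ℝ × T^d` (for `A ⪰ 0` this is Serre's `‖Tr_m A‖_M`, the second term of (FIper)).
[cite: Serre2024, §1.2 Thm. 3] -/
def spatialTraceMass {X : Type*} [MeasurableSpace X] (A : MatrixMeasure (Option d) X) : ℝ :=
  ∑ i : d, A (some i) (some i) univ

end MatrixMeasure

omit [Fintype d] [DecidableEq d] in
/-- Measurable functions are integrable against the slice measures (finite sums of Dirac masses).
[folklore] -/
theorem integrable_sliceEntry (γ : ℝ → Config N d (UnitAddTorus d)) (t : ℝ) (α : Option d)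
    {g : ℝ × UnitAddTorus d → ℝ} (hg : Measurable g) : (sliceEntry γ t α).Integrable g := by
  rw [sliceEntry]
  refine VectorMeasure.Integrable.finsetSum_vectorMeasure fun p _ => ?_
  unfold VectorMeasure.Integrable
  rw [VectorMeasure.variation_dirac]
  exact (integrable_dirac' hg.stronglyMeasurable (by simp)).smul_measure (by simp)

namespace IsHardSphereTrajectory

variable {ε : ℝ} {γ : ℝ → Config N d (UnitAddTorus d)}

/-- **The billiard tensor is divergence-controlled** (Serre 2024 §5 (16)): along a hard-sphere
trajectory on `T^d`, `M = billiardTensor ε γ a b` (`a ≤ b`) has the row-wise divergence measure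
`ν_α = σ^a_α - σ^b_α`, the difference of the slice measures `Σ_p (u_p)_α δ_{(t, x_p(t))}` at the
two ends of the window. [cite: Serre2024, §5 (16)] -/
theorem billiardTensor_hasSpaceTimeDiv (h : IsHardSphereTrajectory (Torus.geometry d) ε N γ)
    {a b : ℝ} (hab : a ≤ b) :
    (billiardTensor ε γ a b).HasSpaceTimeDiv fun α => sliceEntry γ a α - sliceEntry γ b α := by
  intro ψ₀ ψ hψ₀ hψ hD _
  obtain ⟨C, hb₀, hb⟩ := hD
  rw [h.pairing_billiardTensor_stGradMatrix_eq_slices hψ₀ hψ hb₀ hb hab, ← Finset.sum_neg_distrib]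
  refine Finset.sum_congr rfl fun α _ => ?_
  -- measurability of `Ψ_α`
  have hrepr : Measurable fun q : ℝ × UnitAddTorus d => ((q.1, Torus.repr q.2) : ℝ × EuclideanSpace ℝ d) :=
    measurable_fst.prodMk (Torus.measurable_repr.comp measurable_snd)
  have hmα : Measurable fun q : ℝ × UnitAddTorus d => (α.elim (ψ₀ q.1 q.2) fun k => ψ q.1 q.2 k : ℝ) := by
    cases α with
    | none =>
      have heq : (fun q : ℝ × UnitAddTorus d => ψ₀ q.1 q.2) =
          Torus.stLift ψ₀ ∘ fun q : ℝ × UnitAddTorus d => ((q.1, Torus.repr q.2) : ℝ × EuclideanSpace ℝ d) := by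
        funext q
        simp only [Function.comp_apply, Torus.stLift_apply, Torus.proj_repr]
      simp only [Option.elim_none]
      rw [heq]
      exact hψ₀.continuous.measurable.comp hrepr
    | some k =>
      have heq : (fun q : ℝ × UnitAddTorus d => ψ q.1 q.2 k) =
          (fun y : EuclideanSpace ℝ d => y k) ∘ Torus.stLift ψ ∘
            fun q : ℝ × UnitAddTorus d => ((q.1, Torus.repr q.2) : ℝ × EuclideanSpace ℝ d) := by
        funext q
        simp only [Function.comp_apply, Torus.stLift_apply, Torus.proj_repr]
      simp only [Option.elim_some]
      rw [heq]
      exact (EuclideanSpace.proj k).continuous.measurable.comp (hψ.continuous.measurable.comp hrepr)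
  rw [VectorMeasure.integral_sub_vectorMeasure (integrable_sliceEntry γ a α hmα)
    (integrable_sliceEntry γ b α hmα)]
  ring

omit [DecidableEq d] in
/-- **(17) in this vocabulary**: the spatial trace mass of `M` is
`2 E (b - a) + (ε/2) Σᶠ_{t_c ∈ (a,b]} velocityJump γ t_c`. [cite: Serre2024, §5 (17)] -/
theorem spatialTraceMass_billiardTensor' (h : IsHardSphereTrajectory (Torus.geometry d) ε N γ)
    {a b : ℝ} (hab : a ≤ b) :
    (billiardTensor ε γ a b).spatialTraceMass =
      2 * configEnergy (γ a) * (b - a) +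
        2⁻¹ * ε * ∑ᶠ t ∈ collisionTimes (Torus.geometry d) ε γ ∩ Ioc a b, velocityJump γ t :=
  h.spatialTraceMass_billiardTensor hab

end IsHardSphereTrajectory

end

end Literature.Analysis.FluidPDE
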